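import Literature.MathematicalPhysics.QuantumFieldTheory.Balaban1983to89.B9Eq3105FamThreeCommStepAdjAtDatum
import Literature.MathematicalPhysics.QuantumFieldTheory.Balaban1983to89.B9Eq3105FamThreeLocDiffGOfEBlock
import Literature.MathematicalPhysics.QuantumFieldTheory.Balaban1983to89.B9Eq3105FamThreeTAtLocCfg

/-!
# `Balaban1983to89.B9Eq3105FamThreeRecordsD1Closed` — FAMILY 3 OF (3.105): THE TRANSPOSED (`hV′`) RECORD THEOREM AT THE INNER CUT-OFF `χl_□` WITH THE LOCATED
# `G′`-DIFFERENCE STEP D1 CLOSED ON BOTH SIDES — `hDL □ μ` (p33 E2d) AND `hDR □ ν` (p38 E3∕E3c) DISCHARGED; displayed after this file: `hP3` (D2), the cube-side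
# commutator letters `hR □`∕`hT □` (both ∃-supplied at the datum), the letters' blocks, the units, the (3.35) datum, the transfers, the (2.61)'s and the budgets
# (sub-row G-B9-LETTERS, GAPS G-B9-05 ∕ G-B9-p33-01, programme FAMTHREE FILE F3-PT v2; lead g35 LAYER WORD FAMTHREE-4c and RULING FAMTHREE-6 (2): the `hV′` record is
# this lineage's plug, the `hrest` record's plug is p33 g104's FILE 7 `B9Eq3105FamThreeAtLocCfgOfTails`; seat p38 gen 48)

T. Bałaban, *Propagators for lattice gauge theories in a background field*, Commun. Math. Phys. **99** (1985) 389–434 [`Balaban1985BackgroundPropagators`, "[B9]"];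
[4] = T. Bałaban, *Propagators and renormalization transformations for lattice gauge theories. II*, Commun. Math. Phys. **96** (1984) 223–250 [`Balaban1984PropagatorsII`];
[2] of [B9] = T. Bałaban, *Regularity and decay of lattice Green's functions*, Commun. Math. Phys. **89** (1983) 571–597 [`Balaban1983RegularityDecay`].

statement-level skeleton of published theorems with citation tags; proofs where landed; nothing here is a claim about the Yang–Mills mass gap

THE PRINTED LOCUS (held `paper:balaban1985-cmp99-background-propagators`, journal page = PDF page + 388).  (3.105)–(3.106) p. 414 (the expansion of
`G(U₁) − G_appr` into the families of terms) and p. 415 l. 18–37, in particular l. 29–31 «Next we replace the operators G′_{□₀} and C_{□₀} by G′_□, C_□, terms with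
the differences G′_{□₀} − G′_□ and C_{□₀} − C_□ are small by the same reason as before»; p. 412 l. 22–36 («the operators may differ outside □̃₀, and the distance
from □̃ to □̃₀ᶜ is at least M»); (3.100) p. 413; (3.88)–(3.89) p. 409 (the commutator letters); Cor. 3.6 p. 408 («U′ = U^u = e^{iηA}»); Thm 3.1 (3.42) p. 397; (3.49)
p. 399; (3.87) p. 409; (3.91) p. 410; [4] (2.51)–(2.55) pp. 232–233, (2.46) p. 231, Lemma 2.1 (2.60)–(2.61) p. 234, (2.83)–(2.85) pp. 237–238; [2] (1.11)–(1.12)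
(statement type only).

WHY THIS FILE.  Family 3 of (3.105) is recorded in the tree by two "record" theorems — the `hrest` summand (p33 F3-P `B9Eq3105FamThreeAtLocCfg`, moved to the inner
cut-off `χl_□ = bumpY i (ctrR i □) (3S_j)` by p33 E2d `B9Eq3105FamThreeLocDiffGOfEBlock.hasMajorant_sum_famThree_at_locCfg_chiL`; its plug is p33's FILE 7) and the
transposed `hV′` summand (p38 F3-PT `B9Eq3105FamThreeTAtLocCfg.hasMajorant_sum_famThreeT_at_locLetters`, generic in the cut-off family `χ □`; its own specialisation
`_at_locCfg` sits at `χ := χ_□`, for which NO located-entry supplier can exist — both suppliers live on the collar of the inner bump `χl_□`).  E3c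
(`B9Eq3105FamThreeCommStepAdjAtDatum.hasMajorant_hDR_at_of_cube`) supplies the right located entry `hDR □ ν` at `χl_□` from the consumer's standing data exactly like
E2d's `hasMajorant_hDL_chiL_of_eBlock` supplies the left one `hDL □ μ`.  THIS FILE instantiates F3-PT's `_at_locLetters` at `parS := parSymY i`, `G′ := GpY i (parSymY
i)`, `Ṽ_□ := locCfgY i □ η (A □)`, `χ □ := χl_□` (plateau hypotheses = p38 `chiL_eq_one_of_zetaY_gradK` ∕ `chiL_eq_one_of_hTY_gradK`, site agreement = p33
`agree_of_datum`) with BOTH `hDL` (E2d) and `hDR` (E3c) DISCHARGED and folded to the record's common kernel `ε_T·ℓ(a)·e^{−δ_Td}` (`ε_D^L, ε_D^R ≤ ε_T`, `δ_T ≤ ρ_Eδ_G`,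
`δ_T ≤ ρ_Rδ₀^R`).  p33 g104's D2 supplier (FILE 6 `hasMajorant_hP3_of_tails`) feeds the displayed `hP3 □` BY NAME (the binder is E2d's record's, on this carrier).

WHAT THIS FILE CERTIFIES (kernel-checked; 0 `def`, 0 `def … : Prop`, 0 sorry; standard axioms only)
* `fold_kernel` — the bookkeeping `ε ≤ ε_T`, `δ_T ≤ δ′` ⟹ `ε·ℓ·e^{−δ′t} ≤ ε_T·ℓ·e^{−δ_Tt}` (`ℓ > 0`, `t ≥ 0`, `ε_T ≥ 0`).
* ★★★ `hasMajorant_sum_famThreeT_at_locCfg_chiL` — over `(toB6 (geo9K i) Rr Hp, ιB∘blkOf)` the transposed (`hV′`) family-3 sum at the located projection letters and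
  `χl_□` has F3-PT's kernel (`ε_T` in place of the located budgets), BOTH located entries DISCHARGED; displayed: `hE` (inverse-family `EBlock` of `G′(U₁)`), `hEO`,
  `hCinv`, the cube-side letters `hR □` (p21 D3's order, at `Ṽ_□`; ∃-supplied by p33 E2e `commStep_at_datum`) and `hT □` (the adjoint order, at `Ṽ_□`; ∃-supplied by
  E3c `commStepAdj_at_datum`), `hP3 □` (D2), F3-PT's cube datum `hPlC □`, bi-contractive `parSymY(U₁)` and `u_□`, `IsUnit Δ′_a(U₁)`, `IsUnit Δ′_{a,□}(Ṽ_□^{u⁻¹})`,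
  `η = |c_f|⁻¹`, the (3.35) data `hQ`∕`hgA`, the [4] (2.60) transfers, the cube (2.61)'s at `(δ_c, α_c)` (twice: `RC HC` for `hDL`, `Rr H` for `hDR`), `(δ_t, α_t)` and
  `(δ_C, α_C)`, the member (2.61)'s, and the budgets (`hεDT`, `hδDT` for the left entry; `hεRT`, `hδRT` for the right entry; F3-PT's own).

HONEST SCOPE ∕ NOT CLAIMED.  A plug of landed results (E2d, E3c, F3-PT, p33 F3-P) — no new inequality of [B9] beyond them.  The smallness of the located entries is
the collar factor `e^{−a_sepδ(3M_h∕8 − 3)}` of F3-E2∕F3-E3, not print's `O(M⁻¹)` (not claimed).  What the `hV′` family-3 record still displays after this file: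
`hP3 □` (D2 — p33 g104's F3-B3 FILE 6), the cube-side letters `hR □`, `hT □` (both SUPPLIED over all members above one threshold, by p33 E2e resp. E3c; the
∃-packaging over the thresholds is the assembler's), the letters' blocks `hE`∕`hEO`∕`hCinv`, the units, the (3.35) datum, transfers, (2.61)'s and budgets.  The `hrest`
record is NOT touched here (RULING FAMTHREE-6: p33's FILE 7).  Count-neutral; NOT a node discharge; no summit ∕ sub-problem statement is proved; nothing continuum ∕
OS ∕ mass-gap ∕ Clay; YM mass gap NOT proved (Track A conditional rung).  No `sorry`, no `axiom`, no `… : Prop` fact, no `instance`, no `notation`, no `def`.  NEW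
file; nothing landed is modified.  Cell `lit-balaban`, seat `lit-balaban-p38` gen 48, 2026-08-29; `--supports stmt-QuantumFields-19200`.  Net new unproved facts: 0.

RELATED IN THE TREE, NOT DUPLICATED (searched 2026-08-29: `rg 'RecordsD1Closed|famThreeT_at_locCfg_chiL\b' Literature/` = nothing): p33 E2d
`B9Eq3105FamThreeLocDiffGOfEBlock` (`hasMajorant_sum_famThree_at_locCfg_chiL` — the pattern followed —, `hasMajorant_hDL_chiL_of_eBlock`), p38 E3c
`B9Eq3105FamThreeCommStepAdjAtDatum.hasMajorant_hDR_at_of_cube`, p38 F3-PT `B9Eq3105FamThreeTAtLocCfg.hasMajorant_sum_famThreeT_at_locLetters`, p33 F3-P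
`B9Eq3105FamThreeAtLocCfg.agree_of_datum`, p38 `B9Cor36CollarSeparation.chiL_eq_one_of_{zetaY,hTY}_gradK` — all USED BY NAME.
-/

noncomputable section

namespace Literature.MathematicalPhysics.QuantumFieldTheory.Balaban1983to89.B9Eq3105FamThreeRecordsD1Closed

open NormedSpace Complex
open B6RandomWalk (HasMajorant hasMajorant_mono Ineq261 c1_nonneg)
open B9FromB6 (EBlock)
open B9Thm34Ext (toB6)
open B9Ineq347 (ScaleTransfer)
open B9Eq352DivFormLetters (conj)
open B9Eq352GradLetters (diffLetter)
open B4PartitionUnity22 (thetaProf D1)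
open B6KLevelCensusIndexV1 (KIdx)
open B6Cover236MultiLevelBlocks (cubes)
open B6GlobalChartV1 (blkV1 PV boxEquiv)
open B6Geom246MultiLevelBox (blkOf)
open B6Ineq2142KLevelV1 (β)
open B9GeoNormsKLevelV1 (geo9K)
open B9Eq39Adjoint (fluct)
open B9Eq360DeltaPrimeAY (AfldY)
open B9Eq360DeltaPrimeACubeY (blkCubeY)
open B9Thm37CubeCoverCommutators (cutMulY hTY)
open B9Eq3104CutoffCommutators (hBdY DPDsY)
open B9Eq3105AtLetters (DPDsCubeY)
open B9Eq3105ZetaY (zetaY)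
open B9Eq3105FamThreeAtLocCfg (agree_of_datum)
open B9Eq3105FamThreeTAtLocCfg (hasMajorant_sum_famThreeT_at_locLetters)
open B9Eq3105FamThreeLocDiffGOfEBlock (hasMajorant_hDL_chiL_of_eBlock)
open B9Eq3105FamThreeCommStepAdjAtDatum (hasMajorant_hDR_at_of_cube)
open B9CubeLettersOpsL0 (deltaPrimeACubeY GpCubeY)
open B9CubeLettersBondOpsL0 (QpCubeY QpsCubeY XinvCubeY)
open B9CubeLettersInvReadings (kernelFamilySInv kernelFamilyBInv)
open B9CubeGeometryInputs (geoCK)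
open B9Cor35GCubeInputsAtOne (blkBK)
open B9Cor36CutoffField337 (bumpY)
open B9Cor36CubeCutoffs (SC NearC chiY ctrR locCfgY)
open B9Cor36GCubeLocLetter (locProjBY)
open B9Thm39CinvAtCover (DsepT)
open B9Ineq368PPrime (kappa349)
open B9Eq3105FamTwoCore (geo9K_axioms)
open Node00 (SiteY BlkY IBondY FBondY CfgY GaugeY SiteOpY BondOpY SiteParY BondParY toKT etaS shiftY UboxY QpY QpsY XinvY gradY divY gradK
  gaugeY parSymY parSymY_isGaugeLawS GpY deltaPrimeAY)

variable {d ℓ : ℕ} {hd : 1 ≤ d + 1} {hL : Odd (ℓ + 1) ∧ 1 < ℓ + 1} {b₀ b₁ : ℝ}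
variable {𝔸 : Type} [NormedRing 𝔸] [NormedAlgebra ℂ 𝔸] [CompleteSpace 𝔸]
variable {ι : Type} [Fintype ι]
variable (i : KIdx d ℓ hd hL b₀ b₁) (b : Module.Basis ι ℝ 𝔸)

/-- Kernel bookkeeping (elementary monotonicity, used to fold a located entry to the records' common kernel): `ε ≤ ε_T`, `δ_T ≤ δ′`, `ℓ > 0`, `t ≥ 0`,
`ε_T ≥ 0` ⟹ `ε·ℓ·e^{−δ′t} ≤ ε_T·ℓ·e^{−δ_Tt}`.  The kernel shape `const·ℓ(a)·e^{−δd(a,a′)}` is that of [4] (2.53); nothing of [4] is claimed here.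
[cite: Balaban1984PropagatorsII, (2.51)–(2.55) pp.232–233 (kernel shape only)] -/
theorem fold_kernel {ε εT δ' δT la t : ℝ} (hε : ε ≤ εT) (hδ : δT ≤ δ') (hla : 0 < la) (ht : 0 ≤ t) (hεT : 0 ≤ εT) :
    ε * la * Real.exp (-(δ' * t)) ≤ εT * la * Real.exp (-(δT * t)) :=
  mul_le_mul (mul_le_mul_of_nonneg_right hε hla.le) (Real.exp_le_exp.2 (neg_le_neg (mul_le_mul_of_nonneg_right hδ ht))) (Real.exp_nonneg _)
    (mul_nonneg hεT hla.le)

/-! ## The `hV′` (transposed) family-3 record at `χl_□` with D1 closed on BOTH sides -/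

section HVprime

variable [Fintype (geo9K i).Site] [DecidableEq (geo9K i).Site] {Rr : ℝ} {Hp : Prop}
variable {B : B9.Backgrounds} (cfg : B.Cfg → CfgY 𝔸 i) (par : BondParY 𝔸 i) {U₁ : B.Cfg}

set_option maxHeartbeats 6400000 in
/-- ★★★ **THE `hV′` (TRANSPOSED) FAMILY-3 RECORD AT THE INNER CUT-OFF `χl_□` WITH D1 CLOSED ON BOTH SIDES**: p38 F3-PT's `hasMajorant_sum_famThreeT_at_locLetters` at
`parS := parSymY i`, `G′ := GpY i (parSymY i)`, `Ṽ_□ := locCfgY i □ η (A □)`, `χ □ := χl_□ = bumpY i (ctrR i □) (3S_j)` (plateau hypotheses = p38's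
`chiL_eq_one_of_zetaY_gradK` ∕ `chiL_eq_one_of_hTY_gradK`; site agreement from the datum), with BOTH located entries DISCHARGED — `hDL □ μ` by p33 E2d's
`hasMajorant_hDL_chiL_of_eBlock`, `hDR □ ν` by E3c's `hasMajorant_hDR_at_of_cube` — folded to the common `ε_T·ℓ(a)·e^{−δ_Td}`.  (F3-PT's own `_at_locCfg` sits at
`χ := χ_□`, for which no supplier can exist — the suppliers need the inner bump; this is the usable hV′ record.)  Displayed: `hE`, `hEO`, `hCinv`, the cube-side letters `hR □` (p21's order; ∃-supplied by p33 E2e) and `hT □` (adjoint order;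
∃-supplied by E3c `commStepAdj_at_datum`), `hP3 □` (D2), the cube datum `hPlC □`, bi-contractive `parSymY(U₁)` and `u_□`, the units, `η = |c_f|⁻¹`, the (3.35) data, the
transfers, the cube and member (2.61)'s and the budgets — NO located `G′`-difference entry any more.
[cite: Balaban1985BackgroundPropagators, (3.105)–(3.106) p.414, p.415 l.18–37, p.412 l.22–36, (3.100) p.413, (3.88)–(3.89) p.409, Cor. 3.6 p.408, (3.42) p.397, (3.49) p.399, (3.87) p.409, (3.91) p.410; Balaban1983RegularityDecay, (1.11)–(1.12) (statement type); Balaban1984PropagatorsII, (2.51)–(2.55) p.232, (2.46) p.231, (2.83)–(2.85) pp.237–238, Lemma 2.1 (2.60)–(2.61) p.234] -/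
theorem hasMajorant_sum_famThreeT_at_locCfg_chiL
    {BG δG : ℝ} (hE : EBlock (kernelFamilySInv i B cfg (fun W => GpY i (parSymY i) W) (parSymY i)) BG δG U₁) (hBG : 0 ≤ BG) (hδG0 : 0 ≤ δG)
    (Oc : ↥(cubes i.D.toDomains) → BondOpY 𝔸 i) {B₀ δ : ℝ} (hB₀ : 0 ≤ B₀) (hδ : 0 < δ)
    (hEO : ∀ c : ↥(cubes i.D.toDomains), EBlock (kernelFamilyBInv i B cfg (Oc c) par) B₀ δ U₁)
    (ιB : BlkY i → IBondY i) (hι : ∀ s, β i.hN i.D i.hk (ιB s) = s)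
    (hpar : ∀ z w : SiteY i, ‖(parSymY i (cfg U₁) z w : 𝔸)‖ ≤ 1 ∧ ‖(((parSymY i (cfg U₁) z w)⁻¹ : 𝔸ˣ) : 𝔸)‖ ≤ 1)
    {M₂ : ℝ} (hM₂ : 0 ≤ M₂) (hrepr : ∀ (v : 𝔸) (j : ι), |b.repr v j| ≤ M₂ * ‖v‖) (hη : etaS i = |i.cf|⁻¹)
    {s B₁ δX : ℝ} (hs : (etaS i ^ 2 * etaS i ^ 2) * s = 1) (hB₁ : 0 ≤ B₁)
    (hCinv : HasMajorant (g := toB6 (geo9K i) Rr Hp) (fun q : BlkY i × ι => ιB q.1) (conj b (s • (XinvY i (parSymY i) (fun W => GpY i (parSymY i) W) (cfg U₁)).restrictScalars ℝ))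
      (fun a a' => B₁ * ((geo9K i).len a ^ 4)⁻¹ * Real.exp (-(δX * (geo9K i).dist a a'))))
    (u : ↥(cubes i.D.toDomains) → GaugeY 𝔸 i) (hu : ∀ c x, ‖((u c x : 𝔸ˣ) : 𝔸)‖ ≤ 1 ∧ ‖(((u c x)⁻¹ : 𝔸ˣ) : 𝔸)‖ ≤ 1)
    (A : ↥(cubes i.D.toDomains) → AfldY 𝔸 i)
    (Q : ↥(cubes i.D.toDomains) → Set (Site (PV d ℓ i.m i.K hd hL) 0)) (η : ℝ)
    (hQ : ∀ (c : ↥(cubes i.D.toDomains)) (x : Site (PV d ℓ i.m i.K hd hL) 0), NearC i c (35 * SC i c / 8 + 1) (boxEquiv i.hN x).1 → x ∈ Q c)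
    (hgA : ∀ (c : ↥(cubes i.D.toDomains)) (κ : Fin (d + 1)) (x : Site (PV d ℓ i.m i.K hd hL) 0), x ∈ Q c → x.shift κ ∈ Q c →
      gaugeY i (u c) (cfg U₁) κ x = fluct η (A c) κ x)
    (hU : IsUnit (deltaPrimeAY i (parSymY i) (cfg U₁)))
    (hV : ∀ c : ↥(cubes i.D.toDomains), IsUnit (deltaPrimeACubeY i c (parSymY i) (gaugeY i (u c)⁻¹ (locCfgY i c η (A c)))))
    (RC : ℝ) (HC : Prop)
    (dBc dBE : ℕ) {θ δc αc asepE ρE bb : ℝ} (hθ : 0 ≤ θ) (hδc : 0 ≤ δc) (hαc1 : αc ≤ 1) (hasepE : 0 ≤ asepE) (hρE : 0 ≤ ρE) (hsplitE : asepE + ρE ≤ 1)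
    (hrate : bb * δG ≤ (1 - αc) * δc) (h261c : ∀ c : ↥(cubes i.D.toDomains), Ineq261 dBc (toB6 (geoCK i c) RC HC) δc αc)
    (h261E : Ineq261 dBE (toB6 (geo9K i) Rr Hp) δG (bb - ρE))
    (hR : ∀ c : ↥(cubes i.D.toDomains), HasMajorant (g := toB6 (geoCK i c) RC HC) (fun p : SiteY i × ι => blkCubeY i c p.1)
      (conj b (((cutMulY (𝔸 := 𝔸) (chiY i c) * deltaPrimeACubeY i c (parSymY i) (locCfgY i c η (A c)) -
          deltaPrimeACubeY i c (parSymY i) (locCfgY i c η (A c)) * cutMulY (𝔸 := 𝔸) (chiY i c)) * GpCubeY i c (parSymY i) (locCfgY i c η (A c))).restrictScalars ℝ))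
      (fun a s' => θ * Real.exp (-(δc * (geoCK i c).dist a s'))))
    {εT δT : ℝ}
    (hεDT : (M₂ * (∑ j, ‖b j‖) * BG * (1 + D1 thetaProf / 3)) *
          (Real.exp (-(asepE * δG * (3 / 8 * (i.Mh : ℝ) - 1))) +
            ((M₂ * ∑ j, ‖b j‖) ^ 2 * (θ * B6.c1 dBc δc αc)) * B6.c1 dBE δG (bb - ρE) * Real.exp (-(asepE * δG * (3 / 8 * (i.Mh : ℝ) - 2)))) ≤ εT)
    (hδDT : δT ≤ ρE * δG)
    (dBt : ℕ) {θt δt αt : ℝ} (hθt : 0 ≤ θt) (hδt : 0 ≤ δt) (hαt1 : αt ≤ 1)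
    (h261t : ∀ c : ↥(cubes i.D.toDomains), Ineq261 dBt (toB6 (geoCK i c) RC HC) δt αt)
    (hT : ∀ c : ↥(cubes i.D.toDomains), HasMajorant (g := toB6 (geoCK i c) RC HC) (fun p : SiteY i × ι => blkCubeY i c p.1)
      (conj b ((GpCubeY i c (parSymY i) (locCfgY i c η (A c)) * (deltaPrimeACubeY i c (parSymY i) (locCfgY i c η (A c)) * cutMulY (𝔸 := 𝔸) (chiY i c) -
          cutMulY (𝔸 := 𝔸) (chiY i c) * deltaPrimeACubeY i c (parSymY i) (locCfgY i c η (A c)))).restrictScalars ℝ))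
      (fun a s' => θt * Real.exp (-(δt * (geoCK i c).dist a s'))))
    (dBR : ℕ) {δ₀R aG αR ΛR bK αstR ΛstR asepR ρR : ℝ} (hδ₀R : 0 ≤ δ₀R) (haG : aG * δ₀R ≤ δG) (hαR : 0 ≤ αR) (hΛR : 0 ≤ ΛR)
    (hT1R : ScaleTransfer (geo9K i) δ₀R αR ΛR (fun a => (geo9K i).len a)) (hΛstR : 0 ≤ ΛstR)
    (hTstR : ScaleTransfer (geo9K i) δ₀R αstR ΛstR (fun a => (geo9K i).len a)) (hasepR : 0 ≤ asepR) (hρR : 0 ≤ ρR) (hsplitL : αstR + ρR ≤ bK)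
    (hrateR : bK * δ₀R ≤ (1 - αt) * δt) (hsplitR : αR + asepR + ρR ≤ aG) (h261R : Ineq261 dBR (toB6 (geo9K i) Rr Hp) δ₀R (aG - αR - asepR - ρR))
    (hεRT : (M₂ * (∑ j, ‖b j‖) * BG * (1 + ΛR * (D1 thetaProf / 3)) *
          (Real.exp (-(asepR * δ₀R * (3 / 8 * (i.Mh : ℝ) - 1))) +
            ((M₂ * ∑ j, ‖b j‖) ^ 2 * (θt * B6.c1 dBt δt αt)) * ΛstR * B6.c1 dBR δ₀R (aG - αR - asepR - ρR) *
              Real.exp (-(asepR * δ₀R * (3 / 8 * (i.Mh : ℝ) - 3))))) ≤ εT)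
    (hδRT : δT ≤ ρR * δ₀R)
    (dB : ℕ) {δ₀ δP α β' ρ Λ : ℝ} (hΛ : 1 ≤ Λ) (hρ : 0 ≤ ρ) (hα : 0 ≤ α) (hβ : 0 ≤ β') (hδ₀ : 0 ≤ δ₀)
    (hδG' : δP ≤ δG) (hδX' : δP ≤ δX) (hδD' : δP ≤ δT) (hr : ρ + (2 * α + β') * δ₀ ≤ δP)
    (h261 : Ineq261 dB (toB6 (geo9K i) Rr Hp) δ₀ β')
    (hT1 : ScaleTransfer (geo9K i) δ₀ α Λ (fun a => (geo9K i).len a)) (hT2 : ScaleTransfer (geo9K i) δ₀ α Λ (fun a => (geo9K i).len a ^ 2))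
    (hT4 : ScaleTransfer (geo9K i) δ₀ α Λ (fun a => ((geo9K i).len a ^ 4)⁻¹))
    {ε₃ : ℝ} (hε₃ : 0 ≤ ε₃)
    (hP3 : ∀ c : ↥(cubes i.D.toDomains), HasMajorant (g := toB6 (geo9K i) Rr Hp) (fun p : FBondY i × ι => ιB (blkV1 i.hN i.D p.1))
      (conj b ((gradY i (cfg U₁) ∘ₗ (cutMulY (𝔸 := 𝔸) (bumpY i (ctrR i c) (3 * (SC i c : ℝ))) ∘ₗ
        (GpCubeY i c (parSymY i) (gaugeY i (u c)⁻¹ (locCfgY i c η (A c))) ∘ₗ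
          ((QpsY i (parSymY i) (cfg U₁) ∘ₗ XinvY i (parSymY i) (fun W => GpY i (parSymY i) W) (cfg U₁) ∘ₗ QpY i (parSymY i) (cfg U₁))
            - (QpsCubeY i c (parSymY i) (gaugeY i (u c)⁻¹ (locCfgY i c η (A c))) ∘ₗ
                XinvCubeY i c (parSymY i) (gaugeY i (u c)⁻¹ (locCfgY i c η (A c))) ∘ₗ
                QpCubeY i c (parSymY i) (gaugeY i (u c)⁻¹ (locCfgY i c η (A c))))) ∘ₗ
          GpCubeY i c (parSymY i) (gaugeY i (u c)⁻¹ (locCfgY i c η (A c)))) ∘ₗ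
        cutMulY (𝔸 := 𝔸) (bumpY i (ctrR i c) (3 * (SC i c : ℝ)))) ∘ₗ divY i (cfg U₁)).restrictScalars ℝ))
      (fun a y => ε₃ * ((geo9K i).len a ^ 2)⁻¹ * Real.exp (-(ρ * (geo9K i).dist a y))))
    (dC : ℕ) {KC δC αC : ℝ} (hKC : 0 ≤ KC) (hδC : 0 ≤ δC) (hαC1 : αC ≤ 1)
    (h261C : ∀ c : ↥(cubes i.D.toDomains), Ineq261 dC (toB6 (geoCK i c) RC HC) δC αC)
    (hPlC : ∀ c : ↥(cubes i.D.toDomains), HasMajorant (g := toB6 (geoCK i c) RC HC) (blkBK i c)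
      (conj b ((DPDsCubeY i c (parSymY i) (locCfgY i c η (A c))).restrictScalars ℝ))
      (fun a s' => KC * ((geoCK i c).len a ^ 2)⁻¹ * Real.exp (-(δC * (geoCK i c).dist a s'))))
    (dB' : ℕ) {asep ρ₁ ρ' αst Λ' : ℝ} (hasep : 0 ≤ asep) (hΛ' : 0 ≤ Λ') (hρ' : 0 ≤ ρ')
    (hsplitP : asep + ρ₁ ≤ ρ / δ) (hsplitC : asep * δ + ρ₁ * δ ≤ (1 - αC) * δC) (hsplit : αst + ρ' ≤ 1)
    (h261' : Ineq261 dB' (toB6 (geo9K i) Rr Hp) δ (ρ₁ - ρ')) (hST : ScaleTransfer (geo9K i) δ αst Λ' (fun a => ((geo9K i).len a ^ 2)⁻¹)) :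
    HasMajorant (g := toB6 (geo9K i) Rr Hp) (fun p : FBondY i × ι => ιB (blkV1 i.hN i.D p.1))
      (∑ c : ↥(cubes i.D.toDomains), conj b ((cutMulY (𝔸 := 𝔸) (hBdY i (hTY i c)) * Oc c (cfg U₁) * cutMulY (𝔸 := 𝔸) (hBdY i (hTY i c)) *
        (cutMulY (𝔸 := 𝔸) (hBdY i (zetaY i c)) *
          (DPDsY i (parSymY i) (fun W => GpY i (parSymY i) W) (cfg U₁) - locProjBY i c (parSymY i) (u c) (locCfgY i c η (A c))))).restrictScalars ℝ))
      (fun a b' => (3 * 5 ^ (d + 1)) *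
        (((M₂ * (∑ j, ‖b j‖) * B₀) *
            ((((M₂ * ∑ j, ‖b j‖) * (M₂ * ∑ j, ‖b j‖) * B₁ * Λ ^ 4 * B6.c1 dB δ₀ β' ^ 2 *
                  (((d : ℝ) + 1) * εT * (2 * (M₂ * (∑ j, ‖b j‖) * BG) + εT)) + ε₃) +
              (kappa349 (M₂ * ∑ j, ‖b j‖) (((d : ℝ) + 1) * (M₂ * (∑ j, ‖b j‖) * BG)) B₁ Λ (B6.c1 dB δ₀ β') +
                (M₂ * ∑ j, ‖b j‖) ^ 2 * (KC * B6.c1 dC δC αC)) * Real.exp (-(asep * δ * DsepT i)))) * Λ' * B6.c1 dB' δ (ρ₁ - ρ')) *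
          Real.exp (-(ρ' * δ * (geo9K i).dist a b')))) := by
  obtain ⟨-, -, hdnn⟩ := geo9K_axioms i Rr Hp
  have hSum : 0 ≤ M₂ * ∑ j, ‖b j‖ := mul_nonneg hM₂ (Finset.sum_nonneg fun j _ => norm_nonneg _)
  have hεD : 0 ≤ (M₂ * (∑ j, ‖b j‖) * BG * (1 + D1 thetaProf / 3)) *
      (Real.exp (-(asepE * δG * (3 / 8 * (i.Mh : ℝ) - 1))) +
        ((M₂ * ∑ j, ‖b j‖) ^ 2 * (θ * B6.c1 dBc δc αc)) * B6.c1 dBE δG (bb - ρE) * Real.exp (-(asepE * δG * (3 / 8 * (i.Mh : ℝ) - 2)))) := by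
    have h1 : 0 ≤ 1 + D1 thetaProf / 3 := by
      have := B4PartitionUnity22.D1_nonneg B4PartitionUnity22.contDiff_thetaProf B4PartitionUnity22.hasCompactSupport_thetaProf
      positivity
    have h2 : 0 ≤ B6.c1 dBc δc αc := c1_nonneg _ _ _
    have h3 : 0 ≤ B6.c1 dBE δG (bb - ρE) := c1_nonneg _ _ _
    positivity
  have hεT : 0 ≤ εT := hεD.trans hεDT
  have hDL : ∀ (c : ↥(cubes i.D.toDomains)) (μ : Fin (d + 1)), HasMajorant (g := toB6 (geo9K i) Rr Hp) (fun p : SiteY i × ι => ιB (blkOf i.D.toDomains p.1))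
      (conj b (diffLetter (shiftY i) (UboxY i (cfg U₁)) (((etaS i : ℝ) : ℂ))⁻¹ (Sum.inl μ)) *
        conj b ((etaS i ^ 2) • (cutMulY (𝔸 := 𝔸) (bumpY i (ctrR i c) (3 * (SC i c : ℝ))) ∘ₗ
          ((fun W => GpY i (parSymY i) W) (cfg U₁) - GpCubeY i c (parSymY i) (gaugeY i (u c)⁻¹ (locCfgY i c η (A c))))).restrictScalars ℝ))
      (fun a a' => εT * (geo9K i).len a * Real.exp (-(δT * (geo9K i).dist a a'))) := fun c μ =>
    hasMajorant_mono (g := toB6 (geo9K i) Rr Hp) _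
      (hasMajorant_hDL_chiL_of_eBlock i c b cfg hE hBG hδG0 ιB hι hM₂ hrepr hη (u c) (hu c) η (A c) (hQ c) (hgA c) hU (hV c) μ dBc dBE
        hθ hδc hαc1 hasepE hρE hsplitE hrate (h261c c) h261E (hR c))
      fun a a' => fold_kernel hεDT hδDT (B9GeoLemma21KLevelV1.geo9K_len_pos i a) (hdnn a a') hεT
  have hDR : ∀ (c : ↥(cubes i.D.toDomains)) (ν : Fin (d + 1)), HasMajorant (g := toB6 (geo9K i) Rr Hp) (fun p : SiteY i × ι => ιB (blkOf i.D.toDomains p.1))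
      (conj b ((etaS i ^ 2) • (((fun W => GpY i (parSymY i) W) (cfg U₁) - GpCubeY i c (parSymY i) (gaugeY i (u c)⁻¹ (locCfgY i c η (A c)))) ∘ₗ
          cutMulY (𝔸 := 𝔸) (bumpY i (ctrR i c) (3 * (SC i c : ℝ)))).restrictScalars ℝ) *
        conj b (diffLetter (shiftY i) (UboxY i (cfg U₁)) (((etaS i : ℝ) : ℂ))⁻¹ (Sum.inr ν)))
      (fun a a' => εT * (geo9K i).len a * Real.exp (-(δT * (geo9K i).dist a a'))) := fun c ν =>
    hasMajorant_mono (g := toB6 (geo9K i) Rr Hp) _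
      (hasMajorant_hDR_at_of_cube i c b cfg hE hBG ιB hι hM₂ hrepr hη ν (u c) (hu c) η (A c) (hQ c) (hgA c) hU (hV c) dBt hθt hδt hαt1 (h261t c) (hT c)
        dBR hδ₀R haG hαR hΛR hT1R hΛstR hTstR hasepR hρR hsplitL hrateR hsplitR h261R)
      fun a a' => fold_kernel hεRT hδRT (B9GeoLemma21KLevelV1.geo9K_len_pos i a) (hdnn a a') hεT
  exact hasMajorant_sum_famThreeT_at_locLetters i b cfg (fun W => GpY i (parSymY i) W) (parSymY i) par (parSymY_isGaugeLawS i) hE hBG Oc hB₀ hδ hEO ιB hι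
    hpar hM₂ hrepr hη hs hB₁ hCinv u hu (fun c => locCfgY i c η (A c)) (fun c w hw κ => agree_of_datum i c (u c) (cfg U₁) (A c) (Q c) η (hQ c) (hgA c) w hw κ)
    (fun c => bumpY i (ctrR i c) (3 * (SC i c : ℝ))) (fun c _ _ hf hz => B9Cor36CollarSeparation.chiL_eq_one_of_zetaY_gradK i c hf hz)
    (fun c _ _ hf hz => B9Cor36CollarSeparation.chiL_eq_one_of_hTY_gradK i c hf hz) hεT hDL hDR dB hΛ hρ hα hβ hδ₀ hδG' hδX' hδD' hr h261 hT1 hT2 hT4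
    hε₃ hP3 RC HC dC hKC hδC hαC1 h261C hPlC dB' hasep hΛ' hρ' hsplitP hsplitC hsplit h261' hST

end HVprime

end Literature.MathematicalPhysics.QuantumFieldTheory.Balaban1983to89.B9Eq3105FamThreeRecordsD1Closed

end
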